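import Summits.QuantumAdvantage.QuantumAdvantage.Theorems.LightDialC3

/-! # LightDialC4 — part C4 — two minority ones: the ARC VECTOR, its kernel law and sign bit

NODE «LightDial» (decomp-qadv lens-2 g26) — the PREDECESSOR WITNESS `predW_b(x) = E_b + 2·E_b·O_b + 2·x_{b+1} (mod 3)` (`E_b/O_b` = number
of ones at the positions of the same / the other parity as `b`, even ring): an explicit rotation-covariant QUADRATIC strategy that is perfect on
every odd-class input of Hamming weight `≤ 5` at every even length — so `¬ LightFail 2 3` and `¬ LightFail 2 5` are THEOREMS (parts C3, C5) and the
law-bet piece `LightFail 2 w → NoPerfectTwo3` of the dial (Theorems.LightDialA/B) is to be read at `w ≥ 7` (numerically the threshold is exactly 7: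
g26 `num/Q-STRUCTURE.md`, critic 69v66). Five files C1 → … → C5 (gate form ≤ 400 lines each); rung 0, nothing here bears on 27432 itself.

THIS FILE: §14 (first half): configuration `TwoMinority x p c c'` (minority ones exactly `c ≠ c'`, arc from `c` to `c'` holding evenly many majority
ones), the ARC VECTOR `arcVec` (majority positions in the arc; minority positions preceded by an even number of arc majority ones), ★
`TwoMinority.inKernel_arcVec`, `kvec_eq_arcVec`, `wtAnd_arcVec = e + 2`, ★ BOUNDARY PAIRING `edgesIn_arcVec = 2·|mint| + 2`, `signBit_arcVec =
(e/2 + 1) % 2`, and the witness's answers on a `(3,2)` input (`predAns_of_par_eq`, `predAns_of_par_ne`).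
-/

set_option linter.dupNamespace false
set_option linter.unnecessarySeqFocus false
noncomputable section
open scoped Classical

namespace Summit.QuantumAdvantage.QuantumAdvantage.Theorems.LightDial
open Finset
open Literature.Computability.QuantumComplexity Literature.Computability.QuantumComplexity.RingHLF
open Literature.Computability.MetaComplexity Literature.Computability.MetaComplexity.Smolensky
open Summit.QuantumAdvantage.AdviceFreeQNC0
open Summit.QuantumAdvantage.QuantumAdvantage.Theorems.RingPeriodFold (kvec kernel_pair_of_oddZeros kvec_ne_zero rel_iff_of_kernel_pair)

variable {n : ℕ}

/-! ## §14 Two minority ones: the arc vector -/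

/-- counting below a capped threshold = counting inside the arc. -/
theorem cnt_mono (x : Fin n → Bool) (p : ℕ) (c : Fin n) {s t : ℕ} (hst : s ≤ t) : cnt x p c s ≤ cnt x p c t := by
  unfold cnt; apply Finset.card_le_card; intro i; simp only [mem_filter, mem_univ, true_and]
  rintro ⟨h1, h2, h3⟩; exact ⟨h1, h2, by omega⟩

/-- ★ the ARC VECTOR of an input unrolled at the minority one `c` with arc end `c'`: a majority-parity (`p`) position iff it lies in the
arc (offset `< toff c c'`), a minority-parity position iff an EVEN number of arc majority ones precede it. -/
def arcVec (x : Fin n → Bool) (p : ℕ) (c c' : Fin n) : Fin n → Bool :=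
  fun j => if par j = p then decide (toff c j < toff c c')
    else decide (cnt x p c (min (toff c j) (toff c c')) % 2 = 0)

/-- hypotheses of the two-minority configuration (oriented): even ring, the minority-parity ones are exactly `c ≠ c'`, every other one has
parity `p < 2`, and the arc from `c` to `c'` holds an even number of majority ones. -/
structure TwoMinority (x : Fin n → Bool) (p : ℕ) (c c' : Fin n) : Prop where
  /-- the ring length is even -/
  even : Even n
  /-- and at least `3` -/
  three : 3 ≤ n
  /-- `c` is a one -/
  hc : x c = true
  /-- `c'` is a one -/
  hc' : x c' = true
  /-- `c ≠ c'` -/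
  hcc : c ≠ c'
  /-- `c` has minority parity -/
  hpc : par c ≠ p
  /-- `c'` has minority parity -/
  hpc' : par c' ≠ p
  /-- `p` is a parity -/
  hp2 : p < 2
  /-- the minority-parity ones are among `c, c'` -/
  hmin : ∀ j, x j = true → par j ≠ p → j = c ∨ j = c'
  /-- the arc holds an even number of majority ones -/
  harc : cnt x p c (toff c c') % 2 = 0

namespace TwoMinority
variable {x : Fin n → Bool} {p : ℕ} {c c' : Fin n}

/-- the arc end: a nonzero EVEN offset, hence `2 ≤ T ≤ n - 2`. -/
theorem T_pos (h : TwoMinority x p c c') : toff c c' ≠ 0 := fun e => h.hcc ((toff_eq_zero_iff c c').mp e).symm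

/-- the arc end has even offset (same parity as `c`). -/
theorem T_even (h : TwoMinority x p c c') : toff c c' % 2 = 0 := by
  have m := toff_mod_two h.even c c'; have := par_lt_two c; have := par_lt_two c'; have := h.hpc; have := h.hpc'; have := h.hp2
  omega

/-- hence `T + 2 ≤ n`. -/
theorem T_le (h : TwoMinority x p c c') : toff c c' + 2 ≤ n := by
  have h1 := h.T_pos; have h2 := h.T_even; have h3 := toff_lt c c'; obtain ⟨m, hm⟩ := h.even; omega

/-- offsets of majority-parity positions are odd, of minority-parity positions even. -/
theorem toff_odd_of_par_eq (h : TwoMinority x p c c') {b : Fin n} (hb : par b = p) : toff c b % 2 = 1 := by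
  have m := toff_mod_two h.even c b; have := par_lt_two c; have := par_lt_two b; have := h.hpc; have := h.hp2; omega

/-- … and minority-parity positions have even offset. -/
theorem toff_even_of_par_ne (h : TwoMinority x p c c') {b : Fin n} (hb : par b ≠ p) : toff c b % 2 = 0 := by
  have m := toff_mod_two h.even c b; have := par_lt_two c; have := par_lt_two b; have := h.hpc; have := h.hp2; omega

/-- a minority-parity one is `c` or `c'`; anything else of minority parity is a zero. -/
theorem x_eq_false_of_par_ne (h : TwoMinority x p c c') {b : Fin n} (hb : par b ≠ p) (h1 : b ≠ c) (h2 : b ≠ c') : x b = false := by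
  by_contra hx; rw [Bool.not_eq_false] at hx
  rcases h.hmin b hx hb with e | e
  · exact h1 e
  · exact h2 e

/-- `c` lies in the arc vector (empty count). -/
@[simp] theorem arcVec_c (h : TwoMinority x p c c') : arcVec x p c c' c = true := by
  simp [arcVec, h.hpc, cnt_zero]

/-- `c'` lies in the arc vector (the full arc count is even). -/
theorem arcVec_c' (h : TwoMinority x p c c') : arcVec x p c c' c' = true := by
  simp [arcVec, h.hpc', h.harc]

/-- so the arc vector is nonzero. -/
theorem arcVec_ne_zero (h : TwoMinority x p c c') : arcVec x p c c' ≠ fun _ => false := by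
  intro h0; have := congrFun h0 c; rw [h.arcVec_c] at this; exact Bool.noConfusion this

/-- ★ KERNEL LAW (two minority ones, even arc): the arc vector is a kernel vector. -/
theorem inKernel_arcVec (h : TwoMinority x p c c') : InKernel x (arcVec x p c c') := by
  intro b
  have hpn := par_nxt h.even b; have hpp := par_prv h.even b; have hb2 := par_lt_two b; have hp2 := h.hp2
  have hT0 := h.T_pos; have hT2 := h.T_even; have hTn := h.T_le
  set T := toff c c' with hT
  by_cases hb : par b = p
  · -- majority-parity position `b` (odd offset `t ≥ 1`): neighbours are minority and read off the capped count
    have hn' : par (nxt b) ≠ p := by unfold par at *; omega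
    have hp' : par (prv b) ≠ p := by unfold par at *; omega
    have htodd := h.toff_odd_of_par_eq hb
    have ht0 : toff c b ≠ 0 := by omega
    have hVb : arcVec x p c c' b = decide (toff c b < T) := by simp [arcVec, hb, hT]
    have hVn : arcVec x p c c' (nxt b) = decide (cnt x p c (min (toff c (nxt b)) T) % 2 = 0) := by simp [arcVec, hn', hT]
    have hVp : arcVec x p c c' (prv b) = decide (cnt x p c (min (toff c (prv b)) T) % 2 = 0) := by simp [arcVec, hp', hT]
    rw [hVb, hVn, hVp, toff_prv, if_neg ht0]
    by_cases hin : toff c b < T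
    · -- inside the arc: no wrap, caps inactive, the count two steps on differs by `[x b]`
      have hlast : toff c b + 1 < n := by omega
      rw [toff_nxt, if_pos hlast, min_eq_left (by omega : toff c b + 1 ≤ T), min_eq_left (by omega : toff c b - 1 ≤ T)]
      have hstep : cnt x p c (toff c b + 1) = cnt x p c (toff c b - 1) + (if x b = true then 1 else 0) := by
        have e1 : toff c b = (toff c b - 1) + 1 := by omega
        rw [cnt_succ, card_at_eq hb]
        conv_lhs => rw [e1, cnt_succ]
        rw [card_at_eq_zero, Nat.add_zero]
        intro i hi ⟨_, hip⟩
        have m1 := toff_mod_two h.even c i; have m2 := toff_mod_two h.even c b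
        unfold par at *; omega
      rw [hstep, decide_eq_true hin]
      cases x b <;> simp <;> omega
    · -- outside the arc: both caps active (or the wrap to `c`), both neighbours read the full (even) arc count
      rw [min_eq_right (by omega : T ≤ toff c b - 1)]
      have hdec : decide (toff c b < T) = false := decide_eq_false hin
      rw [hdec, Bool.and_false]
      by_cases hlast : toff c b + 1 < n
      · rw [toff_nxt, if_pos hlast, min_eq_right (by omega : T ≤ toff c b + 1)]; simp
      · rw [toff_nxt, if_neg hlast, Nat.zero_min, cnt_zero, h.harc]; simp
  · -- minority-parity position `b` (even offset): neighbours are majority and read off the arc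
    have hn' : par (nxt b) = p := by unfold par at *; omega
    have hp' : par (prv b) = p := by unfold par at *; omega
    have hteven := h.toff_even_of_par_ne hb
    have htlt := toff_lt c b
    obtain ⟨m, hm⟩ := h.even
    have hVn : arcVec x p c c' (nxt b) = decide (toff c (nxt b) < T) := by simp [arcVec, hn', hT]
    have hVp : arcVec x p c c' (prv b) = decide (toff c (prv b) < T) := by simp [arcVec, hp', hT]
    have hlast : toff c b + 1 < n := by omega
    rw [hVn, hVp, toff_nxt, if_pos hlast, toff_prv]
    by_cases hbc : b = c
    · subst hbc
      rw [toff_self, if_pos rfl, h.arcVec_c, h.hc]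
      rw [decide_eq_false (by omega : ¬ n - 1 < T), decide_eq_true (by omega : 0 + 1 < T)]; rfl
    · have ht0 : toff c b ≠ 0 := fun e => hbc ((toff_eq_zero_iff c b).mp e)
      rw [if_neg ht0]
      by_cases hbc' : b = c'
      · subst hbc'
        rw [h.arcVec_c', h.hc', decide_eq_true (by omega : toff c b - 1 < T), decide_eq_false (by omega : ¬ toff c b + 1 < T)]; rfl
      · have hTne : toff c b ≠ T := fun e => hbc' (toff_injective c (by rw [e]))
        rw [h.x_eq_false_of_par_ne hb hbc hbc', Bool.false_and]
        by_cases hlt : toff c b < T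
        · rw [decide_eq_true (by omega : toff c b - 1 < T), decide_eq_true (by omega : toff c b + 1 < T)]; rfl
        · rw [decide_eq_false (by omega : ¬ toff c b - 1 < T), decide_eq_false (by omega : ¬ toff c b + 1 < T)]; rfl

/-- hence the arc vector IS the canonical kernel vector (odd class). -/
theorem kvec_eq_arcVec (h : TwoMinority x p c c') (hx : OddZeros x) : kvec x = arcVec x p c c' := by
  rcases (kernel_pair_of_oddZeros h.three hx _).mp h.inKernel_arcVec with e | e
  · exact absurd e h.arcVec_ne_zero
  · exact e.symm

/-! ### sign bit of the arc vector: `e/2 + 1 (mod 2)`, `e` = number of arc majority ones -/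

/-- the arc vector meets exactly the arc majority ones and the two minority ones. -/
theorem wtAnd_arcVec (h : TwoMinority x p c c') : wtAnd x (arcVec x p c c') = cnt x p c (toff c c') + 2 := by
  unfold wtAnd cnt
  have hset : (univ.filter fun i : Fin n => x i = true ∧ arcVec x p c c' i = true) =
      (univ.filter fun i : Fin n => x i = true ∧ par i = p ∧ toff c i < toff c c') ∪ {c, c'} := by
    ext i; simp only [mem_filter, mem_univ, true_and, mem_union, mem_insert, mem_singleton]
    constructor
    · rintro ⟨hi, hV⟩
      by_cases hpi : par i = p
      · left; refine ⟨hi, hpi, ?_⟩; simpa [arcVec, hpi] using hV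
      · right; exact h.hmin i hi hpi
    · rintro (⟨hi, hpi, ht⟩ | rfl | rfl)
      · exact ⟨hi, by simp [arcVec, hpi, ht]⟩
      · exact ⟨h.hc, h.arcVec_c⟩
      · exact ⟨h.hc', h.arcVec_c'⟩
  rw [hset, Finset.card_union_of_disjoint, Finset.card_pair h.hcc]
  rw [Finset.disjoint_left]; intro i hi hi2
  simp only [mem_filter, mem_univ, true_and] at hi
  simp only [mem_insert, mem_singleton] at hi2
  rcases hi2 with rfl | rfl
  · exact h.hpc hi.2.1
  · exact h.hpc' hi.2.1

/-- the INTERIOR minority members of the arc vector (offset strictly between `c` and `c'`). -/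
def mint (x : Fin n → Bool) (p : ℕ) (c c' : Fin n) : Finset (Fin n) :=
  univ.filter fun j : Fin n => par j ≠ p ∧ arcVec x p c c' j = true ∧ 0 < toff c j ∧ toff c j < toff c c'

/-- ★ BOUNDARY PAIRING: every interior minority member carries two edges of the vector, `c` and `c'` one each — the edge count is even. -/
theorem edgesIn_arcVec (h : TwoMinority x p c c') : edgesIn (arcVec x p c c') = 2 * (mint x p c c').card + 2 := by
  have hp2 := h.hp2; have hT0 := h.T_pos; have hT2 := h.T_even; have hTn := h.T_le
  obtain ⟨m, hm⟩ := h.even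
  unfold edgesIn
  set T := toff c c' with hT
  set E := univ.filter fun b : Fin n => arcVec x p c c' b = true ∧ arcVec x p c c' (nxt b) = true with hE
  have hsplit := Finset.card_filter_add_card_filter_not (s := E) (fun b : Fin n => par b = p)
  -- edges starting at a majority position: their END is `c'` or an interior minority member
  have h1 : E.filter (fun b : Fin n => par b = p) = (insert c' (mint x p c c')).image prv := by
    ext b; simp only [hE, mint, mem_filter, mem_univ, true_and, mem_image, mem_insert]
    have hpn := par_nxt ⟨m, hm⟩ b; have hb2 := par_lt_two b
    constructor
    · rintro ⟨⟨hVb, hVn⟩, hb⟩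
      have hn' : par (nxt b) ≠ p := by unfold par at *; omega
      have hin : toff c b < T := by simpa [arcVec, hb, hT] using hVb
      have htodd := h.toff_odd_of_par_eq hb
      have hnx : toff c (nxt b) = toff c b + 1 := by rw [toff_nxt, if_pos (by omega)]
      refine ⟨nxt b, ?_, prv_nxt b⟩
      by_cases hend : toff c b + 1 = T
      · left; exact toff_injective c (by rw [hnx, hend, hT])
      · right; exact ⟨hn', hVn, by omega, by omega⟩
    · rintro ⟨j, hj, rfl⟩
      have hpp := par_prv ⟨m, hm⟩ j; have hj2 := par_lt_two j
      rcases hj with hjc | ⟨hjp, hVj, hj0, hjT⟩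
      · rw [hjc]
        have hb : par (prv c') = p := by have := h.hpc'; have := par_lt_two c'; have := par_prv ⟨m, hm⟩ c'; unfold par at *; omega
        refine ⟨⟨?_, by rw [nxt_prv]; exact h.arcVec_c'⟩, hb⟩
        simp only [arcVec, hb, if_true, decide_eq_true_eq]
        rw [toff_prv, if_neg hT0]; omega
      · have hb : par (prv j) = p := by unfold par at *; omega
        refine ⟨⟨?_, by rw [nxt_prv]; exact hVj⟩, hb⟩
        simp only [arcVec, hb, if_true, decide_eq_true_eq]
        rw [toff_prv, if_neg (by omega)]; omega
  -- edges starting at a minority position: the START is `c` or an interior minority member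
  have h2 : E.filter (fun b : Fin n => ¬ par b = p) = insert c (mint x p c c') := by
    ext b; simp only [hE, mint, mem_filter, mem_univ, true_and, mem_insert]
    have hpn := par_nxt ⟨m, hm⟩ b; have hb2 := par_lt_two b
    constructor
    · rintro ⟨⟨hVb, hVn⟩, hb⟩
      have hn' : par (nxt b) = p := by unfold par at *; omega
      have hteven := h.toff_even_of_par_ne hb; have htlt := toff_lt c b
      have hnx : toff c (nxt b) = toff c b + 1 := by rw [toff_nxt, if_pos (by omega)]
      have hin : toff c b + 1 < T := by rw [← hnx]; simpa [arcVec, hn', hT] using hVn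
      by_cases hb0 : toff c b = 0
      · left; exact (toff_eq_zero_iff c b).mp hb0
      · right; exact ⟨hb, hVb, by omega, by omega⟩
    · rintro (hbc | ⟨hbp, hVb, hb0, hbT⟩)
      · rw [hbc]
        have hn' : par (nxt c) = p := by have := h.hpc; have := par_lt_two c; have := par_nxt ⟨m, hm⟩ c; unfold par at *; omega
        refine ⟨⟨h.arcVec_c, ?_⟩, h.hpc⟩
        simp only [arcVec, hn', if_true, decide_eq_true_eq]
        rw [toff_nxt, toff_self, if_pos (by omega)]; omega
      · have hn' : par (nxt b) = p := by unfold par at *; omega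
        have hteven := h.toff_even_of_par_ne hbp
        refine ⟨⟨hVb, ?_⟩, hbp⟩
        simp only [arcVec, hn', if_true, decide_eq_true_eq]
        rw [toff_nxt, if_pos (by omega)]; omega
  have hc'nm : c' ∉ mint x p c c' := by simp [mint]
  have hcnm : c ∉ mint x p c c' := by simp [mint]
  rw [h1, h2, Finset.card_image_of_injective _ prv_injective, Finset.card_insert_of_notMem hc'nm,
    Finset.card_insert_of_notMem hcnm] at hsplit
  omega

/-- ★ SIGN LAW (two minority ones): sign bit `e/2 + 1 (mod 2)`. -/
theorem signBit_arcVec (h : TwoMinority x p c c') :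
    signBit x (arcVec x p c c') = (cnt x p c (toff c c') / 2 + 1) % 2 := by
  unfold signBit; rw [h.edgesIn_arcVec, h.wtAnd_arcVec]; have := h.harc; omega

/-! ### the witness's answers on a `(3,2)` input -/

/-- a majority-parity output sees the two minority ones as the other parity. -/
theorem ocnt_of_par_eq (h : TwoMinority x p c c') {b : Fin n} (hb : par b = p) : ocnt b x = 2 := by
  unfold ocnt; rw [hb]
  have hset : (univ.filter fun j : Fin n => x j = true ∧ par j ≠ p) = {c, c'} := by
    ext j; simp only [mem_filter, mem_univ, true_and, mem_insert, mem_singleton]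
    constructor
    · rintro ⟨hj, hpj⟩; exact h.hmin j hj hpj
    · rintro (rfl | rfl)
      · exact ⟨h.hc, h.hpc⟩
      · exact ⟨h.hc', h.hpc'⟩
  rw [hset, Finset.card_pair h.hcc]

/-- a minority-parity output sees the two minority ones as its own parity … -/
theorem ecnt_of_par_ne (h : TwoMinority x p c c') {b : Fin n} (hb : par b ≠ p) : ecnt b x = 2 := by
  have hb2 := par_lt_two b; have hp2 := h.hp2; have := par_lt_two c; have := par_lt_two c'; have := h.hpc; have := h.hpc'
  unfold ecnt
  have hset : (univ.filter fun j : Fin n => x j = true ∧ par j = par b) = {c, c'} := by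
    ext j; simp only [mem_filter, mem_univ, true_and, mem_insert, mem_singleton]
    constructor
    · rintro ⟨hj, hpj⟩; exact h.hmin j hj (by omega)
    · rintro (rfl | rfl)
      · exact ⟨h.hc, by omega⟩
      · exact ⟨h.hc', by omega⟩
  rw [hset, Finset.card_pair h.hcc]

/-- … and the `k` majority ones as the other parity. -/
theorem ocnt_of_par_ne (h : TwoMinority x p c c') {b : Fin n} (hb : par b ≠ p) :
    ocnt b x = (univ.filter fun i : Fin n => x i = true ∧ par i = p).card := by
  have hb2 := par_lt_two b; have hp2 := h.hp2
  unfold ocnt; congr 1; ext i; simp only [mem_filter, mem_univ, true_and]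
  have hi2 := par_lt_two i
  constructor
  · rintro ⟨hi, hpi⟩
    refine ⟨hi, ?_⟩
    by_contra hne
    have := par_lt_two c; have := par_lt_two c'; have := h.hpc; have := h.hpc'
    rcases h.hmin i hi hne with rfl | rfl <;> omega
  · rintro ⟨hi, hpi⟩; exact ⟨hi, by omega⟩

/-- `15 + 2·x_{b+1} ≢ 1`: a majority-parity output answers nothing. -/
theorem predAns_of_par_eq (h : TwoMinority x p c c') (hk : (univ.filter fun i : Fin n => x i = true ∧ par i = p).card = 3)
    {b : Fin n} (hb : par b = p) : predAns x b = false := by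
  have hval : predW b x = ((3 : ℕ) : ZMod 3) + 2 * ((3 : ℕ) : ZMod 3) * ((2 : ℕ) : ZMod 3) + 2 * (if x (nxt b) = true then 1 else 0) := by
    unfold predW; rw [OneMinority.ecnt_of_par_eq hb, h.ocnt_of_par_eq hb, hk]
  simp only [predAns, hval]
  by_cases ht : x (nxt b) = true
  · rw [if_pos ht]; decide
  · rw [if_neg ht]; decide

/-- `14 + 2·x_{b+1} ≡ 1 ⟺ x_{b+1} = 1`: a minority-parity output answers the predecessor rule. -/
theorem predAns_of_par_ne (h : TwoMinority x p c c') (hk : (univ.filter fun i : Fin n => x i = true ∧ par i = p).card = 3)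
    {b : Fin n} (hb : par b ≠ p) : predAns x b = x (nxt b) := by
  have hval : predW b x = ((2 : ℕ) : ZMod 3) + 2 * ((2 : ℕ) : ZMod 3) * ((3 : ℕ) : ZMod 3) + 2 * (if x (nxt b) = true then 1 else 0) := by
    unfold predW; rw [h.ecnt_of_par_ne hb, h.ocnt_of_par_ne hb, hk]
  simp only [predAns, hval]
  by_cases ht : x (nxt b) = true
  · rw [if_pos ht, ht]; decide
  · rw [if_neg ht, Bool.eq_false_iff.mpr ht]; decide

end TwoMinority

end Summit.QuantumAdvantage.QuantumAdvantage.Theorems.LightDial
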